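import Literature.IUT.HodgeArakelov.StableCurveAgreementFamiliesNonVacuity
import Literature.IUT.HodgeArakelov.LabelClassesOfCuspsRmk241ProCyclic
import Literature.IUT.HodgeTheaters.CompactAbelianProLPart
import Literature.IUT.HodgeTheaters.DiscreteProfiniteCompletionsProofs
import Literature.AnabelianGeometry.AbsoluteAnabelian.ZHatCompletionFreeProcyclic
import HarnessLib

/-!
# [IUTchII] Rmk 2.4.1 «its maximal pro-`l′` subgroup … every closed subgroup of such a maximal pro-`l′` subgroup is either open or
# trivial» — DECIDED: the maximal pro-`l′` subgroup of any `I ≃ₜ* Ẑ` is `≃ₜ* ℤ_{l′}`; the statement of record at the genuine tower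
# (FACT row F-2063, proof-only, 0 defs)

S. Mochizuki, *Inter-universal Teichmüller Theory II*, kurims manuscript (Dec. 2020), §2, Remark 2.4.1, p. 71: «one may replace “`I_t`” in
Corollary 2.4 by its maximal pro-`l′` subgroup for any `l′ ∈ 𝔓𝔯𝔦𝔪𝔢𝔰 \ {p_v}`.  The use of such maximal pro-`l′` subgroups sometimes results in a
simplification of arguments involving intersections with various open subgroups, since every closed subgroup of such a maximal pro-`l′` subgroup is
either open or trivial.» ([IUTchII] Rmk 2.4.1, kurims p.71) [cite: Mochizuki2012, II Rmk 2.4.1 p.71] [claim: Mochizuki2012, status: disputed] (D-0012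
claim key; this file is classical profinite group theory about `Ẑ` and `ℤ_{l′}` plus by-name instantiation; nothing of the series is asserted).
abc-iut cell, D-0079 L-F sub-cell F6, FACT row **F-2063** `Rmk241_openOrTrivial'` (statement of record, `LabelClassesOfCuspsR2.lean` p408509), node
IUTchII:Rmk2.4.1; seat abc-iut-L6-t19 gen 7.  PROOF-ONLY sequel of `LabelClassesOfCuspsRmk241ProCyclic.lean` (p441868: the dichotomy for every
subgroup `≃ₜ* ℤ_{l′}`) and `StableCurveAgreementFamiliesNonVacuity.lean` (p448223: the cuspidal inertia groups `I_t` at the tower of record are `≃ₜ* Ẑ`).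

THE POINT.  p441868 proves the printed dichotomy for any subgroup HANDED an isomorphism with `ℤ_{l′}`; what print applies it to is «the maximal
pro-`l′` subgroup of `I_t`», `I_t ≅ Ẑ(1)` a cuspidal inertia group.  In the tree's vocabulary (abc-iut-L5-t11's `CompactAbelianProLPart`: the pro-`l`
part of a compact group `Z` with commuting elements is `Z_(l) = {x | ∀ open normal W ≤ Z, ∃ n, x^{l^n} ∈ W}`) this file proves:

* §1 `not_forall_rmk241_openOrTrivial'` — the UNIVERSAL CLOSURE of the schema is false (`I′ = ℤ × ℤ` discrete: `ℤ × 0` is closed, nontrivial, of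
  infinite index), so the row is a schema to be decided at its instances;
* §2 in `∏_p ℤ_p`: the pro-`l` part is exactly the `l`-th factor (`padicProd_forall_exists_pow_mem_iff`), and that factor is `≃ₜ* ℤ_l`
  (`nonempty_continuousMulEquiv_padicInt_of_factor`);
* §3 the pro-`l`-part predicate is transported along isomorphisms of topological groups (`forall_exists_pow_mem_iff_of_continuousMulEquiv`);
* §4 for ANY topological group `G`, ANY subgroup `I ≤ G` with `I ≃ₜ* Ẑ` (Mathlib's profinite completion of `ℤ` = the tree's `SemiGraphs.ZHat`) and
  ANY prime `l`: the maximal pro-`l` subgroup `Λ ≤ I` EXISTS, is UNIQUE, is `≃ₜ* ℤ_l` (`nonempty_continuousMulEquiv_padicInt_of_maximalProL`, through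
  abc-iut-L4-t6's `ZHatCompletion.exists_continuousMulEquiv_padicProd : Ẑ ≃ₜ* ∏_p ℤ_p`), hence satisfies the statement of record
  `Rmk241_openOrTrivial' Λ` (`rmk241_openOrTrivial'_of_maximalProL_of_equiv_zHat`, by p441868) and is nontrivial and infinite;
* §5 AT THE TOWER OF RECORD `PlusMinusTower.ofPiCHat` (abc-iut-L6-t19 p430122) with the agreement datum of record (abc-iut-w5-d132 p434636 /
  package p441069): for every cuspidal inertia group `I_t` of `Π_v` (the `I_t ⊆ Π_v` of Cor 2.4) resp. of `Π^±_v`, and EVERY prime `l′` (print: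
  `l′ ≠ p_v`; the restriction is not needed for the dichotomy), the maximal pro-`l′` subgroup of `I_t` satisfies `Rmk241_openOrTrivial'` and is
  `≃ₜ* ℤ_{l′}` (`rmk241_openOrTrivial'_maximalProL_of_isCuspidalInertia_piV_ofPiCHat`, `…_piPM_ofPiCHat`), NON-VACUOUSLY
  (`exists_maximalProL_rmk241_ofPiCHat`: given one cusp of `X`, such `I_t` and `Λ` exist).

HONEST LIMITS: the `Ẑ(1)`-shape of `I_t` is abc-iut-L3's interface field transported (p443151/p448223), not proved here; binders of §5 are those of
p448223 (L02 `hZ`, `hN`, the special-fibre DATA of `X̲_v`, `X̲̲_v`, a cusp of `X`).  No new `def`, no instance, no edit of any other seat's file;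
consistency ≠ endorsement; no side taken on [IUTchIII] Cor. 3.12; typed ≠ proved for the series' claims.
-/

noncomputable section

namespace Literature.IUT.HodgeArakelov

open Literature.AnabelianGeometry.EtaleTheta Literature.AnabelianGeometry.SemiGraphs Literature.IUT.HodgeTheaters
open Literature.AnabelianGeometry.AbsoluteAnabelian (ZHatCompletion.exists_continuousMulEquiv_padicProd)
open scoped Pointwise

universe u

/-! ## §1 The universal closure of the schema is false -/

/-- **F-2063 is a SCHEMA, not a closed fact**: the universal closure of `Rmk241_openOrTrivial'` over all topological groups and subgroups is FALSE
— in the discrete group `ℤ × ℤ` (`I′ = ⊤`) the subgroup `ℤ × 0` is closed, nontrivial and of infinite index.  (Print applies the dichotomy only to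
«such a maximal pro-`l′` subgroup», a copy of `ℤ_{l′}`: §4–§5 below.) ([IUTchII] Rmk 2.4.1, kurims p.71) [cite: Mochizuki2012, II Rmk 2.4.1 p.71]
[claim: Mochizuki2012, status: disputed] -/
theorem not_forall_rmk241_openOrTrivial' :
    ¬ ∀ (G : Type) [Group G] [TopologicalSpace G] (I' : Subgroup G), Rmk241_openOrTrivial' I' := by
  intro h
  set K : Subgroup (Multiplicative ℤ × Multiplicative ℤ) := (MonoidHom.snd (Multiplicative ℤ) (Multiplicative ℤ)).ker with hK
  rcases h (Multiplicative ℤ × Multiplicative ℤ) ⊤ K le_top (isClosed_discrete _) with hbot | hfin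
  · have hmem : ((Multiplicative.ofAdd (1 : ℤ), 1) : Multiplicative ℤ × Multiplicative ℤ) ∈ K := by
      rw [hK, MonoidHom.mem_ker, MonoidHom.coe_snd]
    rw [hbot, Subgroup.mem_bot, Prod.mk_eq_one] at hmem
    exact absurd (congrArg Multiplicative.toAdd hmem.1) (by decide)
  · have hidx : (K.subgroupOf ⊤).index = 0 := by
      change K.relIndex ⊤ = 0
      rw [Subgroup.relIndex_top_right, hK, Subgroup.index_ker, MonoidHom.range_eq_top.mpr Prod.snd_surjective,
        Subgroup.card_top, Nat.card_congr Multiplicative.toAdd]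
      exact Nat.card_eq_zero_of_infinite
    exact hfin.index_ne_zero hidx

/-! ## §2 The pro-`l` part of `∏_p ℤ_p` is the `l`-th factor, a copy of `ℤ_l` -/

section PadicProd

/-- In `∏_p ℤ_p` (multiplicatively written), an element supported at the prime `l` has, in every open (normal) subgroup `W`, some `l^n`-th power:
`W` contains a basic neighbourhood of `1` constraining finitely many coordinates, and `‖l^n x_l‖ ≤ l^{-n} → 0`. [cite: RibesZalesskii2010, Thm 2.7.1] -/
theorem padicProd_exists_pow_mem_of_apply_eq_zero {l : ℕ} (hl : l.Prime)
    (x : Multiplicative (∀ p : Nat.Primes, @PadicInt (p : ℕ) ⟨p.2⟩))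
    (hx : ∀ p : Nat.Primes, (p : ℕ) ≠ l → Multiplicative.toAdd x p = 0)
    (W : OpenNormalSubgroup (Multiplicative (∀ p : Nat.Primes, @PadicInt (p : ℕ) ⟨p.2⟩))) :
    ∃ n : ℕ, x ^ l ^ n ∈ W.toSubgroup := by
  set i₀ : Nat.Primes := ⟨l, hl⟩ with hi₀
  haveI : Fact (Nat.Prime (i₀ : ℕ)) := ⟨i₀.2⟩
  -- the open set `W` pulled back to the additive product, a neighbourhood of `0`
  set s : Set (∀ p : Nat.Primes, @PadicInt (p : ℕ) ⟨p.2⟩) :=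
    Multiplicative.ofAdd ⁻¹' (W.toSubgroup : Set (Multiplicative (∀ p : Nat.Primes, @PadicInt (p : ℕ) ⟨p.2⟩))) with hs
  have hsO : IsOpen s := W.toOpenSubgroup.isOpen.preimage continuous_ofAdd
  have h0s : (0 : ∀ p : Nat.Primes, @PadicInt (p : ℕ) ⟨p.2⟩) ∈ s := by
    change Multiplicative.ofAdd (0 : ∀ p : Nat.Primes, @PadicInt (p : ℕ) ⟨p.2⟩) ∈ W.toSubgroup
    rw [ofAdd_zero]
    exact W.toSubgroup.one_mem
  obtain ⟨I, u, hu, hIs⟩ := isOpen_pi_iff.mp hsO 0 h0s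
  -- the exponent: if the `l`-coordinate is constrained, make `‖l^n x_l‖ ≤ l^{-n}` smaller than a ball inside `u l`
  obtain ⟨n, hn⟩ : ∃ n : ℕ, i₀ ∈ I →
      ∃ ε : ℝ, ((i₀ : ℕ) : ℝ) ^ (-(n : ℤ)) < ε ∧ Metric.ball (0 : @PadicInt (i₀ : ℕ) ⟨i₀.2⟩) ε ⊆ u i₀ := by
    by_cases hi : i₀ ∈ I
    · obtain ⟨ε, hε, hball⟩ := Metric.isOpen_iff.mp (hu i₀ hi).1 0 (hu i₀ hi).2
      obtain ⟨n, hn⟩ := PadicInt.exists_pow_neg_lt (i₀ : ℕ) hε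
      exact ⟨n, fun _ => ⟨ε, hn, hball⟩⟩
    · exact ⟨0, fun h => absurd h hi⟩
  refine ⟨n, ?_⟩
  -- `x ^ l^n = ofAdd (l^n • x)` lies in the basic neighbourhood
  have hmem : (l ^ n • Multiplicative.toAdd x) ∈ s := by
    refine hIs (Set.mem_pi.mpr fun i hiI => ?_)
    by_cases hil : (i : ℕ) = l
    · have hieq : i = i₀ := Subtype.ext hil
      subst hieq
      obtain ⟨ε, hε, hball⟩ := hn hiI
      refine hball ?_
      rw [mem_ball_zero_iff, Pi.smul_apply, nsmul_eq_mul, Nat.cast_pow]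
      have hcast : ((l : ℕ) : @PadicInt (i₀ : ℕ) ⟨i₀.2⟩) = ((i₀ : ℕ) : @PadicInt (i₀ : ℕ) ⟨i₀.2⟩) := rfl
      rw [hcast]
      calc ‖((i₀ : ℕ) : @PadicInt (i₀ : ℕ) ⟨i₀.2⟩) ^ n * Multiplicative.toAdd x i₀‖
          ≤ ‖((i₀ : ℕ) : @PadicInt (i₀ : ℕ) ⟨i₀.2⟩) ^ n‖ * ‖Multiplicative.toAdd x i₀‖ := norm_mul_le _ _
        _ ≤ ((i₀ : ℕ) : ℝ) ^ (-(n : ℤ)) * 1 := by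
          rw [PadicInt.norm_p_pow]
          exact mul_le_mul_of_nonneg_left (PadicInt.norm_le_one _) (zpow_nonneg (Nat.cast_nonneg _) _)
        _ < ε := by rw [mul_one]; exact hε
    · rw [Pi.smul_apply, hx i hil, smul_zero]
      exact (hu i hiI).2
  have : Multiplicative.ofAdd (l ^ n • Multiplicative.toAdd x) ∈ W.toSubgroup := hmem
  rwa [ofAdd_nsmul, ofAdd_toAdd] at this

/-- Conversely, an element of the pro-`l` part of `∏_p ℤ_p` is supported at `l`: for `p ≠ l` and every `k` the subgroup `{y | y_p ∈ p^k ℤ_p}` is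
open, it contains some `x^{l^n}`, and `l^n` is a unit of `ℤ_p`, so `x_p ∈ ⋂_k p^k ℤ_p = 0`. [cite: RibesZalesskii2010, Thm 2.7.1] -/
theorem padicProd_apply_eq_zero_of_forall_exists_pow_mem {l : ℕ} (hl : l.Prime)
    (x : Multiplicative (∀ p : Nat.Primes, @PadicInt (p : ℕ) ⟨p.2⟩))
    (hx : ∀ W : OpenNormalSubgroup (Multiplicative (∀ p : Nat.Primes, @PadicInt (p : ℕ) ⟨p.2⟩)),
      ∃ n : ℕ, x ^ l ^ n ∈ W.toSubgroup)
    (p : Nat.Primes) (hp : (p : ℕ) ≠ l) : Multiplicative.toAdd x p = 0 := by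
  haveI : Fact (Nat.Prime (p : ℕ)) := ⟨p.2⟩
  -- evaluation at `p`, multiplicatively
  set φ : Multiplicative (∀ q : Nat.Primes, @PadicInt (q : ℕ) ⟨q.2⟩) →* Multiplicative (@PadicInt (p : ℕ) ⟨p.2⟩) :=
    (Pi.evalAddMonoidHom (fun q : Nat.Primes => @PadicInt (q : ℕ) ⟨q.2⟩) p).toMultiplicative with hφ
  have hφc : Continuous φ := continuous_ofAdd.comp ((continuous_apply p).comp continuous_toAdd)
  -- `x_p ∈ p^k ℤ_p` for every `k`
  have hmem : ∀ k : ℕ, Multiplicative.toAdd x p ∈ (Ideal.span {((p : ℕ) : @PadicInt (p : ℕ) ⟨p.2⟩) ^ k} : Ideal _) := by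
    intro k
    set J : Ideal (@PadicInt (p : ℕ) ⟨p.2⟩) := Ideal.span {((p : ℕ) : @PadicInt (p : ℕ) ⟨p.2⟩) ^ k} with hJ
    have hJo : IsOpen (J : Set (@PadicInt (p : ℕ) ⟨p.2⟩)) := by
      have hset : (J : Set (@PadicInt (p : ℕ) ⟨p.2⟩)) = Metric.closedBall 0 (((p : ℕ) : ℝ) ^ (-(k : ℤ))) := by
        ext y
        rw [SetLike.mem_coe, hJ, ← PadicInt.norm_le_pow_iff_mem_span_pow, Metric.mem_closedBall, dist_zero_right]
      rw [hset]
      exact IsUltrametricDist.isOpen_closedBall _ (zpow_pos (by exact_mod_cast p.2.pos) _).ne'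
    let W : OpenNormalSubgroup (Multiplicative (∀ q : Nat.Primes, @PadicInt (q : ℕ) ⟨q.2⟩)) :=
      { toSubgroup := (AddSubgroup.toSubgroup J.toAddSubgroup).comap φ
        isOpen' := (hJo.preimage continuous_toAdd).preimage hφc
        isNormal' := inferInstance }
    obtain ⟨n, hn⟩ := hx W
    -- `x ^ l^n ∈ W` reads `l^n * x_p ∈ J`
    have hn' : ((l ^ n : ℕ) : @PadicInt (p : ℕ) ⟨p.2⟩) * Multiplicative.toAdd x p ∈ J := by
      have h1 : Multiplicative.toAdd (φ (x ^ l ^ n)) ∈ J := hn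
      rwa [map_pow, toAdd_pow, hφ, AddMonoidHom.toMultiplicative_apply_apply, toAdd_ofAdd, Pi.evalAddMonoidHom_apply,
        nsmul_eq_mul] at h1
    -- `l^n` is a unit of `ℤ_p`
    have hunit : IsUnit ((l ^ n : ℕ) : @PadicInt (p : ℕ) ⟨p.2⟩) := by
      rw [Nat.cast_pow]
      refine IsUnit.pow n ?_
      rw [PadicInt.isUnit_iff, PadicInt.norm_natCast_eq_one_iff]
      exact (Nat.coprime_primes p.2 hl).mpr hp
    exact (Ideal.unit_mul_mem_iff_mem J hunit).mp hn'
  -- hence `‖x_p‖ ≤ p^{-k}` for all `k`, so `x_p = 0`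
  by_contra hne
  obtain ⟨k, hk⟩ := PadicInt.exists_pow_neg_lt (p : ℕ) (norm_pos_iff.mpr hne)
  exact absurd ((PadicInt.norm_le_pow_iff_mem_span_pow _ k).mpr (hmem k)) (not_le.mpr hk)

/-- **The pro-`l` part of `∏_p ℤ_p` is the `l`-th factor**: `x` lies in the pro-`l` part (every open normal subgroup contains some `x^{l^n}`) iff
its coordinates at the primes `p ≠ l` vanish. [cite: RibesZalesskii2010, Thm 2.7.1] -/
theorem padicProd_forall_exists_pow_mem_iff {l : ℕ} (hl : l.Prime)
    (x : Multiplicative (∀ p : Nat.Primes, @PadicInt (p : ℕ) ⟨p.2⟩)) :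
    (∀ W : OpenNormalSubgroup (Multiplicative (∀ p : Nat.Primes, @PadicInt (p : ℕ) ⟨p.2⟩)), ∃ n : ℕ, x ^ l ^ n ∈ W.toSubgroup) ↔
      ∀ p : Nat.Primes, (p : ℕ) ≠ l → Multiplicative.toAdd x p = 0 :=
  ⟨fun h => padicProd_apply_eq_zero_of_forall_exists_pow_mem hl x h,
    fun h => padicProd_exists_pow_mem_of_apply_eq_zero hl x h⟩

/-- **The `l`-th factor of `∏_p ℤ_p` is `≃ₜ* ℤ_l`**: a subgroup `Q` consisting exactly of the elements supported at `l` is isomorphic, as a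
topological group, to `ℤ_l` (evaluation at `l`: a continuous bijective homomorphism from the compact `Q` to the Hausdorff `ℤ_l`).
[cite: RibesZalesskii2010, Thm 2.7.1] -/
theorem nonempty_continuousMulEquiv_padicInt_of_factor {l : ℕ} [hl : Fact l.Prime]
    (Q : Subgroup (Multiplicative (∀ p : Nat.Primes, @PadicInt (p : ℕ) ⟨p.2⟩)))
    (hQ : ∀ y, y ∈ Q ↔ ∀ p : Nat.Primes, (p : ℕ) ≠ l → Multiplicative.toAdd y p = 0) :
    Nonempty (↥Q ≃ₜ* Multiplicative ℤ_[l]) := by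
  classical
  set i₀ : Nat.Primes := ⟨l, hl.out⟩ with hi₀
  -- evaluation at `l` on `Q`
  let f : ↥Q →* Multiplicative ℤ_[l] :=
    ((Pi.evalAddMonoidHom (fun q : Nat.Primes => @PadicInt (q : ℕ) ⟨q.2⟩) i₀).toMultiplicative).comp Q.subtype
  have hf : ∀ y : ↥Q, f y = Multiplicative.ofAdd (Multiplicative.toAdd (y : Multiplicative (∀ p : Nat.Primes, @PadicInt (p : ℕ) ⟨p.2⟩)) i₀) :=
    fun _ => rfl
  have hf_cont : Continuous f :=
    continuous_ofAdd.comp ((continuous_apply i₀).comp (continuous_toAdd.comp continuous_subtype_val))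
  have hf_inj : Function.Injective f := by
    intro a b hab
    apply Subtype.ext
    apply Multiplicative.toAdd.injective
    funext q
    by_cases hq : (q : ℕ) = l
    · have hqi : q = i₀ := Subtype.ext hq
      subst hqi
      have h := congrArg Multiplicative.toAdd hab
      rw [hf, hf, toAdd_ofAdd, toAdd_ofAdd] at h
      exact h
    · rw [(hQ _).mp a.2 q hq, (hQ _).mp b.2 q hq]
  have hf_surj : Function.Surjective f := by
    intro z
    refine ⟨⟨Multiplicative.ofAdd (Pi.single i₀ (Multiplicative.toAdd z)), (hQ _).mpr fun q hq => ?_⟩, ?_⟩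
    · have hqi : q ≠ i₀ := fun h => hq (by rw [h])
      rw [toAdd_ofAdd, Pi.single_eq_of_ne hqi]
    · apply Multiplicative.toAdd.injective
      rw [hf, toAdd_ofAdd, Subgroup.coe_mk, toAdd_ofAdd, Pi.single_eq_same]
  -- `Q` is closed in the compact `∏_p ℤ_p`, hence compact; `ℤ_l` is Hausdorff
  have hQc : IsClosed (Q : Set (Multiplicative (∀ p : Nat.Primes, @PadicInt (p : ℕ) ⟨p.2⟩))) := by
    have hset : (Q : Set (Multiplicative (∀ p : Nat.Primes, @PadicInt (p : ℕ) ⟨p.2⟩))) =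
        ⋂ q : {q : Nat.Primes // (q : ℕ) ≠ l},
          (fun y : Multiplicative (∀ p : Nat.Primes, @PadicInt (p : ℕ) ⟨p.2⟩) => Multiplicative.toAdd y q.1) ⁻¹' {0} := by
      ext y
      rw [SetLike.mem_coe, hQ, Set.mem_iInter]
      exact ⟨fun h q => h q.1 q.2, fun h q hq => h ⟨q, hq⟩⟩
    rw [hset]
    exact isClosed_iInter fun q => (isClosed_singleton.preimage ((continuous_apply q.1).comp continuous_toAdd))
  haveI : CompactSpace ↥Q := isCompact_iff_compactSpace.mp hQc.isCompact
  haveI : T2Space (Multiplicative ℤ_[l]) := inferInstanceAs (T2Space ℤ_[l])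
  let gE : ↥Q ≃ Multiplicative ℤ_[l] := Equiv.ofBijective f ⟨hf_inj, hf_surj⟩
  have hgE : Continuous gE := hf_cont
  let gH : ↥Q ≃ₜ Multiplicative ℤ_[l] := Continuous.homeoOfEquivCompactToT2 hgE
  exact ⟨{ MulEquiv.ofBijective f ⟨hf_inj, hf_surj⟩ with
    continuous_toFun := hf_cont
    continuous_invFun := gH.symm.continuous }⟩

end PadicProd

/-! ## §3 The pro-`l`-part predicate is transported along isomorphisms of topological groups -/

section Transport

variable {Z Z' : Type*} [Group Z] [TopologicalSpace Z] [Group Z'] [TopologicalSpace Z']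

/-- Along an isomorphism of topological groups `e : Z ≃ₜ* Z'`, `x` lies in the pro-`l` part of `Z` iff `e x` lies in the pro-`l` part of `Z'`
(open normal subgroups pull back along `e` and `e⁻¹`). [cite: RibesZalesskii2010, Thm 2.7.1] -/
theorem forall_exists_pow_mem_iff_of_continuousMulEquiv (e : Z ≃ₜ* Z') (l : ℕ) (x : Z) :
    (∀ W : OpenNormalSubgroup Z, ∃ n : ℕ, x ^ l ^ n ∈ W.toSubgroup) ↔
      ∀ W' : OpenNormalSubgroup Z', ∃ n : ℕ, (e x) ^ l ^ n ∈ W'.toSubgroup := by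
  constructor
  · intro h W'
    let W : OpenNormalSubgroup Z :=
      { toOpenSubgroup := W'.toOpenSubgroup.comap e.toMulEquiv.toMonoidHom e.continuous
        isNormal' := Subgroup.Normal.comap inferInstance _ }
    obtain ⟨n, hn⟩ := h W
    refine ⟨n, ?_⟩
    have hn' : e.toMulEquiv.toMonoidHom (x ^ l ^ n) ∈ W'.toSubgroup := hn
    rwa [map_pow] at hn'
  · intro h W
    let W' : OpenNormalSubgroup Z' :=
      { toOpenSubgroup := W.toOpenSubgroup.comap e.symm.toMulEquiv.toMonoidHom e.symm.continuous
        isNormal' := Subgroup.Normal.comap inferInstance _ }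
    obtain ⟨n, hn⟩ := h W'
    refine ⟨n, ?_⟩
    have hn' : e.symm ((e x) ^ l ^ n) ∈ W.toSubgroup := hn
    rwa [← map_pow e x (l ^ n), ContinuousMulEquiv.symm_apply_apply] at hn'

end Transport

/-! ## §4 The maximal pro-`l` subgroup of a subgroup `I ≃ₜ* Ẑ`: existence, uniqueness, `≃ₜ* ℤ_l`, the dichotomy of record -/

section MaximalProL

variable {G : Type u} [Group G] [TopologicalSpace G]

/-- The elements of a subgroup `I ≃ₜ* Ẑ` commute (`Ẑ` is commutative: abc-iut-L5's `ZHat.mul_comm`). [cite: MochizukiSemiAnbd2006, §6 p.71] -/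
theorem mul_comm_of_equiv_zHat {I : Subgroup G} (e : ↥I ≃ₜ* Literature.AnabelianGeometry.SemiGraphs.ZHat) (a b : ↥I) :
    a * b = b * a :=
  e.injective (by rw [map_mul, map_mul, Literature.IUT.HodgeTheaters.ZHat.mul_comm])

/-- **«its maximal pro-`l′` subgroup» EXISTS**: for a subgroup `I ≤ G` with `I ≃ₜ* Ẑ` and any `l`, there is a subgroup `Λ ≤ I` whose elements are
exactly those `x ∈ I` such that every open normal subgroup of `I` contains some `x^{l^n}` — the pro-`l` part of `I` in the vocabulary of
abc-iut-L5-t11's `exists_subgroup_proLPart` («the unique maximal pro-`Σ` subgroup of `I_x`», [IUTchI] Cor 2.5 p. 51), read in `G`.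
([IUTchII] Rmk 2.4.1, kurims p.71) [cite: Mochizuki2012, II Rmk 2.4.1 p.71] [claim: Mochizuki2012, status: disputed] -/
theorem exists_maximalProL_of_equiv_zHat {I : Subgroup G} (e : ↥I ≃ₜ* Literature.AnabelianGeometry.SemiGraphs.ZHat) (l : ℕ) :
    ∃ Λ : Subgroup G, Λ ≤ I ∧
      ∀ x : ↥I, (x : G) ∈ Λ ↔ ∀ W : OpenNormalSubgroup ↥I, ∃ n : ℕ, x ^ l ^ n ∈ W.toSubgroup := by
  obtain ⟨P, hP⟩ := exists_subgroup_proLPart (Z := ↥I) l (mul_comm_of_equiv_zHat e)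
  refine ⟨P.map I.subtype, Subgroup.map_subtype_le P, fun x => ?_⟩
  rw [← hP x]
  constructor
  · rintro ⟨y, hy, hyx⟩
    rwa [← Subtype.ext hyx]
  · intro hx
    exact ⟨x, hx, rfl⟩

/-- **… and is UNIQUE**: two subgroups of `G` inside `I` with the defining property of the maximal pro-`l` subgroup of `I` coincide.
([IUTchII] Rmk 2.4.1, kurims p.71) [cite: Mochizuki2012, II Rmk 2.4.1 p.71] [claim: Mochizuki2012, status: disputed] -/
theorem maximalProL_unique {I Λ Λ' : Subgroup G} {l : ℕ} (hΛI : Λ ≤ I)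
    (hΛ : ∀ x : ↥I, (x : G) ∈ Λ ↔ ∀ W : OpenNormalSubgroup ↥I, ∃ n : ℕ, x ^ l ^ n ∈ W.toSubgroup) (hΛ'I : Λ' ≤ I)
    (hΛ' : ∀ x : ↥I, (x : G) ∈ Λ' ↔ ∀ W : OpenNormalSubgroup ↥I, ∃ n : ℕ, x ^ l ^ n ∈ W.toSubgroup) : Λ = Λ' := by
  ext g
  constructor
  · intro hg
    exact (hΛ' ⟨g, hΛI hg⟩).mpr ((hΛ ⟨g, hΛI hg⟩).mp hg)
  · intro hg
    exact (hΛ ⟨g, hΛ'I hg⟩).mpr ((hΛ' ⟨g, hΛ'I hg⟩).mp hg)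

/-- `H.subgroupOf K ≃ₜ* H` for `H ≤ K` (Mathlib's `subgroupOfEquivOfLe`, with the evident continuity). [folklore] -/
private theorem nonempty_continuousMulEquiv_subgroupOf {H K : Subgroup G} (h : H ≤ K) : Nonempty (↥(H.subgroupOf K) ≃ₜ* ↥H) :=
  ⟨{ Subgroup.subgroupOfEquivOfLe h with
      continuous_toFun := (continuous_subtype_val.comp continuous_subtype_val).subtype_mk _
      continuous_invFun := (continuous_subtype_val.subtype_mk _).subtype_mk _ }⟩

/-- The image of a subgroup under an isomorphism of topological groups is isomorphic to it as a topological group. [folklore] -/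
private theorem nonempty_continuousMulEquiv_map_equiv'' {G' : Type*} [Group G'] [TopologicalSpace G'] (e : G ≃ₜ* G')
    (K : Subgroup G) : Nonempty (↥K ≃ₜ* ↥(K.map e.toMulEquiv.toMonoidHom)) := by
  refine ⟨{ e.toMulEquiv.subgroupMap K with continuous_toFun := ?_, continuous_invFun := ?_ }⟩
  · exact (e.continuous.comp continuous_subtype_val).subtype_mk _
  · exact (e.symm.continuous.comp continuous_subtype_val).subtype_mk _

/-- **«such a maximal pro-`l′` subgroup» is a copy of `ℤ_{l′}`**: for ANY topological group `G`, ANY subgroup `I ≤ G` isomorphic as a topological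
group to `Ẑ` (the profinite completion of `ℤ`), ANY prime `l` and the maximal pro-`l` subgroup `Λ ≤ I` of `I` (defining property as in
`exists_maximalProL_of_equiv_zHat`): `Λ ≃ₜ* ℤ_l`.  [Along `I ≃ₜ* Ẑ ≃ₜ* ∏_p ℤ_p` (abc-iut-L4-t6's `ZHatCompletion.exists_continuousMulEquiv_padicProd`) the
pro-`l` part goes to the pro-`l` part (§3), which is the `l`-th factor (§2), a copy of `ℤ_l`.] ([IUTchII] Rmk 2.4.1, kurims p.71)
[cite: Mochizuki2012, II Rmk 2.4.1 p.71] [cite: RibesZalesskii2010, Thm 2.7.1] [claim: Mochizuki2012, status: disputed] -/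
theorem nonempty_continuousMulEquiv_padicInt_of_maximalProL {I : Subgroup G}
    (e : ↥I ≃ₜ* Literature.AnabelianGeometry.SemiGraphs.ZHat) {l : ℕ} [hl : Fact l.Prime] {Λ : Subgroup G} (hΛI : Λ ≤ I)
    (hΛ : ∀ x : ↥I, (x : G) ∈ Λ ↔ ∀ W : OpenNormalSubgroup ↥I, ∃ n : ℕ, x ^ l ^ n ∈ W.toSubgroup) :
    Nonempty (↥Λ ≃ₜ* Multiplicative ℤ_[l]) := by
  obtain ⟨e₁, -⟩ := ZHatCompletion.exists_continuousMulEquiv_padicProd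
  -- `f : I ≃ₜ* ∏_p ℤ_p`
  let f : ↥I ≃ₜ* Multiplicative (∀ p : Nat.Primes, @PadicInt (p : ℕ) ⟨p.2⟩) := e.trans e₁
  -- the image `Q` of `Λ` (read in `I`) is the `l`-th factor
  set Q : Subgroup (Multiplicative (∀ p : Nat.Primes, @PadicInt (p : ℕ) ⟨p.2⟩)) :=
    (Λ.subgroupOf I).map f.toMulEquiv.toMonoidHom with hQdef
  have hQ : ∀ y, y ∈ Q ↔ ∀ p : Nat.Primes, (p : ℕ) ≠ l → Multiplicative.toAdd y p = 0 := by
    intro y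
    rw [hQdef, Subgroup.mem_map_equiv, Subgroup.mem_subgroupOf, ← padicProd_forall_exists_pow_mem_iff hl.out y]
    have hy : y = f (f.toMulEquiv.symm y) := (f.apply_symm_apply y).symm
    rw [hΛ, forall_exists_pow_mem_iff_of_continuousMulEquiv f l]
    constructor
    · intro h W
      rw [hy]
      exact h W
    · intro h W
      have h' := h W
      rwa [hy] at h'
  obtain ⟨eQ⟩ := nonempty_continuousMulEquiv_padicInt_of_factor Q hQ
  obtain ⟨e₂⟩ := nonempty_continuousMulEquiv_subgroupOf hΛI
  obtain ⟨e₃⟩ := nonempty_continuousMulEquiv_map_equiv'' f (Λ.subgroupOf I)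
  exact ⟨(e₂.symm.trans e₃).trans eQ⟩

/-- **[IUTchII] Rmk 2.4.1 — THE STATEMENT OF RECORD for the maximal pro-`l′` subgroup of any `I ≃ₜ* Ẑ`.**  For ANY topological group `G`, ANY
subgroup `I ≤ G` with `I ≃ₜ* Ẑ`, ANY prime `l′` and the maximal pro-`l′` subgroup `Λ` of `I`: `Rmk241_openOrTrivial' Λ` (p408509) — every subgroup
`K ≤ Λ` closed in `G` is trivial or of finite index in `Λ` («every closed subgroup of such a maximal pro-`l′` subgroup is either open or trivial»).
PROVED: `Λ ≃ₜ* ℤ_{l′}` (`nonempty_continuousMulEquiv_padicInt_of_maximalProL`) and abc-iut-L6-t19's p441868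
`rmk241_openOrTrivial'_of_continuousMulEquiv_padicInt`. ([IUTchII] Rmk 2.4.1, kurims p.71) [cite: Mochizuki2012, II Rmk 2.4.1 p.71]
[claim: Mochizuki2012, status: disputed] -/
theorem rmk241_openOrTrivial'_of_maximalProL_of_equiv_zHat {I : Subgroup G}
    (e : ↥I ≃ₜ* Literature.AnabelianGeometry.SemiGraphs.ZHat) {l : ℕ} [Fact l.Prime] {Λ : Subgroup G} (hΛI : Λ ≤ I)
    (hΛ : ∀ x : ↥I, (x : G) ∈ Λ ↔ ∀ W : OpenNormalSubgroup ↥I, ∃ n : ℕ, x ^ l ^ n ∈ W.toSubgroup) :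
    Rmk241_openOrTrivial' Λ := by
  obtain ⟨eΛ⟩ := nonempty_continuousMulEquiv_padicInt_of_maximalProL e hΛI hΛ
  exact rmk241_openOrTrivial'_of_continuousMulEquiv_padicInt Λ eΛ

/-- The maximal pro-`l` subgroup of any `I ≃ₜ* Ẑ` is nontrivial and infinite (it is a copy of `ℤ_l`). ([IUTchII] Rmk 2.4.1, kurims p.71)
[cite: Mochizuki2012, II Rmk 2.4.1 p.71] [claim: Mochizuki2012, status: disputed] -/
theorem ne_bot_and_infinite_of_maximalProL_of_equiv_zHat {I : Subgroup G}
    (e : ↥I ≃ₜ* Literature.AnabelianGeometry.SemiGraphs.ZHat) {l : ℕ} [Fact l.Prime] {Λ : Subgroup G} (hΛI : Λ ≤ I)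
    (hΛ : ∀ x : ↥I, (x : G) ∈ Λ ↔ ∀ W : OpenNormalSubgroup ↥I, ∃ n : ℕ, x ^ l ^ n ∈ W.toSubgroup) :
    Λ ≠ ⊥ ∧ Infinite ↥Λ := by
  obtain ⟨eΛ⟩ := nonempty_continuousMulEquiv_padicInt_of_maximalProL e hΛI hΛ
  haveI : Infinite (Multiplicative ℤ_[l]) := inferInstanceAs (Infinite ℤ_[l])
  haveI : Infinite ↥Λ := Infinite.of_injective eΛ.symm eΛ.symm.injective
  refine ⟨?_, inferInstance⟩
  intro hbot
  obtain ⟨z, hz⟩ := exists_ne (1 : ↥Λ)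
  exact hz (Subtype.ext (Subgroup.mem_bot.mp (hbot.le z.2)))

end MaximalProL

/-! ## §5 At the tower of record `PlusMinusTower.ofPiCHat`: the maximal pro-`l′` subgroups of the cuspidal inertia groups `I_t` -/

namespace PlusMinusTower

section Record

variable {p : ℕ} [Fact p.Prime] {M : MuTwoSetting p} (e : M.CLevelData)
  {E : M.toThetaSetting.EtaleThetaData} {l : ℕ} (C : E.DoubleUnderline l) {N : ℕ+}
  (μ : M.toThetaSetting.CyclotomeMod l N) (hC : M.toThetaSetting.Compat) (hS : M.toThetaSetting.Sec2Hyps)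
  (hl : l.Prime) (hp2 : p ≠ 2) (hpl : p ≠ l) (hζ : ∃ ζ : M.toThetaSetting.K, IsPrimitiveRoot ζ (4 * l))
  {η : (C.thetaEnvData μ hC hS).PiYdd → MuN p N} (hη : η ∈ (C.thetaEnvData μ hC hS).thetaCocycles)
  (hZ : Thm16Sub.KerToZIsCompactlyGenerated M.toThetaSetting) (hN : (C.Huu.subgroupOf (M.GtpXu l)).Normal)
  {P : TopGroup.{0}} (T : TemperedCoverings (BadPlaceSetting.ofUnderline C μ hC hS hl hp2 hpl hζ hη) P)
  (d : M.toTemperedCurve.GroupLevelData)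
  (Sfu : SpecialFibreData ((M.toThetaSetting.temperedCurveXuOfLevelData l C.l_ne_zero d).toTemperedArithmeticGroup
    (M.toThetaSetting.groupLevelDataXu l C.l_ne_zero d)))
  (h36u : Sfu.Gc.Prop36Hypotheses) (Sigmau SigmaHatu : Set ℕ) (hsubu : Sigmau ⊆ SigmaHatu) (hneu : Sigmau.Nonempty)
  (hprimeu : ∀ q ∈ SigmaHatu, q.Prime) (hpu : p ∉ Sigmau) (TpHu : Subgroup Sfu.chart.G)
  (HatHu : Subgroup (TemperedGraphGroupData.exists_completion_of_prop36 Sfu.Gc h36u Sfu.chart).choose)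
  (hleu : TpHu.map (TemperedGraphGroupData.exists_completion_of_prop36 Sfu.Gc h36u Sfu.chart).choose_spec.choose.toMonoidHom ≤ HatHu)
  (cuspu : {x : (M.toThetaSetting.temperedCurveXuOfLevelData l C.l_ne_zero d).Pt //
    (M.toThetaSetting.temperedCurveXuOfLevelData l C.l_ne_zero d).IsCusp x} → Prop)
  (Sf : SpecialFibreData ((C.temperedCurveXuuOfLevelData C.l_ne_zero d).toTemperedArithmeticGroup
    (C.groupLevelDataXuu C.l_ne_zero d)))
  (h36 : Sf.Gc.Prop36Hypotheses) (Sigma SigmaHat : Set ℕ) (hsub : Sigma ⊆ SigmaHat) (hne : Sigma.Nonempty)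
  (hprime : ∀ q ∈ SigmaHat, q.Prime) (hp : p ∉ Sigma) (TpH : Subgroup Sf.chart.G)
  (HatH : Subgroup (TemperedGraphGroupData.exists_completion_of_prop36 Sf.Gc h36 Sf.chart).choose)
  (hle : TpH.map (TemperedGraphGroupData.exists_completion_of_prop36 Sf.Gc h36 Sf.chart).choose_spec.choose.toMonoidHom ≤ HatH)
  (cuspMeetsH : {x : (C.temperedCurveXuuOfLevelData C.l_ne_zero d).Pt //
    (C.temperedCurveXuuOfLevelData C.l_ne_zero d).IsCusp x} → Prop)

/-- **[IUTchII] Rmk 2.4.1 AT THE TOWER OF RECORD, level `Π^±_v`.**  `W := PlusMinusTower.ofPiCHat …`; `Cu`, `A` the agreement datum of record with the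
[IUTchI] §2 datum of `X̲_v` under clause (i) (`eHat ∘ emb = toHat ∘ plainIso`).  For every cuspidal inertia group `I_t` of `Π^±_v`, EVERY prime `l′`
and the maximal pro-`l′` subgroup `Λ` of `I_t`: `Λ` satisfies the statement of record `Rmk241_openOrTrivial' Λ` and is `≃ₜ* ℤ_{l′}`, nontrivial and
infinite.  PROVED (§4 at `I_t ≃ₜ* Ẑ`, p448223 `equiv_zHat_of_isCuspidalInertia_piPM_ofPiCHat`). ([IUTchII] Rmk 2.4.1, kurims p.71)
[cite: Mochizuki2012, II Rmk 2.4.1 p.71] [claim: Mochizuki2012, status: disputed] -/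
theorem StableCurveAgreement.rmk241_openOrTrivial'_maximalProL_of_isCuspidalInertia_piPM_ofPiCHat
    {Cu : CuspidalInertiaData (ofPiCHat e C μ hC hS hl hp2 hpl hζ hη hZ hN T)}
    (A : StableCurveAgreement (ofPiCHat e C μ hC hS hl hp2 hpl hζ hη hZ hN T) Cu
      (StableCurveTemperedData.ofSpecialFibre (M.toThetaSetting.temperedCurveXuOfLevelData l C.l_ne_zero d)
        (M.toThetaSetting.groupLevelDataXu l C.l_ne_zero d) Sfu h36u Sigmau SigmaHatu hsubu hneu hprimeu hpu TpHu HatHu hleu cuspu))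
    (hA : ∀ w : T.Xplain,
      A.eHat ⟨(ofPiCHat e C μ hC hS hl hp2 hpl hζ hη hZ hN T).emb w, (ofPiCHat e C μ hC hS hl hp2 hpl hζ hη hZ hN T).emb_le_pmHat ⟨w, rfl⟩⟩ =
        (StableCurveTemperedData.ofSpecialFibre (M.toThetaSetting.temperedCurveXuOfLevelData l C.l_ne_zero d)
        (M.toThetaSetting.groupLevelDataXu l C.l_ne_zero d) Sfu h36u Sigmau SigmaHatu hsubu hneu hprimeu hpu TpHu HatHu hleu cuspu).ιX (T.plainIso w))
    {I : Subgroup (ofPiCHat e C μ hC hS hl hp2 hpl hζ hη hZ hN T).Corhat}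
    (hI : Cu.IsCuspidalInertia (ofPiCHat e C μ hC hS hl hp2 hpl hζ hη hZ hN T).piPM I)
    (l' : ℕ) [Fact l'.Prime] {Λ : Subgroup (ofPiCHat e C μ hC hS hl hp2 hpl hζ hη hZ hN T).Corhat} (hΛI : Λ ≤ I)
    (hΛ : ∀ x : ↥I, (x : (ofPiCHat e C μ hC hS hl hp2 hpl hζ hη hZ hN T).Corhat) ∈ Λ ↔ ∀ V : OpenNormalSubgroup ↥I, ∃ n : ℕ, x ^ l' ^ n ∈ V.toSubgroup) :
    Rmk241_openOrTrivial' Λ ∧ Nonempty (↥Λ ≃ₜ* Multiplicative ℤ_[l']) ∧ Λ ≠ ⊥ ∧ Infinite ↥Λ := by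
  obtain ⟨⟨eI⟩, -⟩ := A.equiv_zHat_of_isCuspidalInertia_piPM_ofPiCHat e C μ hC hS hl hp2 hpl hζ hη hZ hN T d Sfu h36u Sigmau SigmaHatu hsubu
    hneu hprimeu hpu TpHu HatHu hleu cuspu hA hI
  exact ⟨rmk241_openOrTrivial'_of_maximalProL_of_equiv_zHat eI hΛI hΛ, nonempty_continuousMulEquiv_padicInt_of_maximalProL eI hΛI hΛ,
    ne_bot_and_infinite_of_maximalProL_of_equiv_zHat eI hΛI hΛ⟩

/-- **[IUTchII] Rmk 2.4.1 AT THE TOWER OF RECORD, level `Π_v`** — the `I_t ⊆ Π_v` of Cor 2.4 («one may replace “`I_t`” in Corollary 2.4 by its maximal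
pro-`l′` subgroup»).  `W := PlusMinusTower.ofPiCHat …` with the `Π_v`-dictionary of the agreement datum (p440804 / package p441069) along
`eV : Π̂_v ⥲ Π̂_{X̲̲_v}`, `eV ∘ emb ∘ incl = toHat ∘ refIso`.  For every cuspidal inertia group `I_t` of `Π_v`, EVERY prime `l′` and the maximal pro-`l′`
subgroup `Λ` of `I_t`: `Rmk241_openOrTrivial' Λ`, `Λ ≃ₜ* ℤ_{l′}`, `Λ ≠ 1`, `Λ` infinite.  PROVED (§4 at `I_t ≃ₜ* Ẑ`, p448223
`equiv_zHat_of_isCuspidalInertia_piV_ofPiCHat`).  (Print restricts to `l′ ≠ p_v`; the dichotomy needs no restriction.) ([IUTchII] Rmk 2.4.1, kurims p.71)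
[cite: Mochizuki2012, II Rmk 2.4.1 p.71] [claim: Mochizuki2012, status: disputed] -/
theorem rmk241_openOrTrivial'_maximalProL_of_isCuspidalInertia_piV_ofPiCHat
    {Cu : CuspidalInertiaData (ofPiCHat e C μ hC hS hl hp2 hpl hζ hη hZ hN T)}
    (eV : ↥(ofPiCHat e C μ hC hS hl hp2 hpl hζ hη hZ hN T).hat ≃ₜ*
      (StableCurveTemperedData.ofSpecialFibre (C.temperedCurveXuuOfLevelData C.l_ne_zero d)
        (C.groupLevelDataXuu C.l_ne_zero d) Sf h36 Sigma SigmaHat hsub hne hprime hp TpH HatH hle cuspMeetsH).PiHat)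
    (hV : ∀ z : P,
      eV ⟨(ofPiCHat e C μ hC hS hl hp2 hpl hζ hη hZ hN T).emb (T.incl z),
          (ofPiCHat e C μ hC hS hl hp2 hpl hζ hη hZ hN T).embP_le_hat ⟨z, rfl⟩⟩ =
        (StableCurveTemperedData.ofSpecialFibre (C.temperedCurveXuuOfLevelData C.l_ne_zero d)
        (C.groupLevelDataXuu C.l_ne_zero d) Sf h36 Sigma SigmaHat hsub hne hprime hp TpH HatH hle cuspMeetsH).ιX (T.refIso z))
    (hdict : ∀ I : Subgroup (ofPiCHat e C μ hC hS hl hp2 hpl hζ hη hZ hN T).Corhat,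
      Cu.IsCuspidalInertia (ofPiCHat e C μ hC hS hl hp2 hpl hζ hη hZ hN T).piV I ↔
        I ≤ (ofPiCHat e C μ hC hS hl hp2 hpl hζ hη hZ hN T).piV ∧
          ∃ (y : (StableCurveTemperedData.ofSpecialFibre (C.temperedCurveXuuOfLevelData C.l_ne_zero d)
        (C.groupLevelDataXuu C.l_ne_zero d) Sf h36 Sigma SigmaHat hsub hne hprime hp TpH HatH hle cuspMeetsH).Cusp)
            (s : (StableCurveTemperedData.ofSpecialFibre (C.temperedCurveXuuOfLevelData C.l_ne_zero d)
        (C.groupLevelDataXuu C.l_ne_zero d) Sf h36 Sigma SigmaHat hsub hne hprime hp TpH HatH hle cuspMeetsH).PiTp),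
            (I.subgroupOf (ofPiCHat e C μ hC hS hl hp2 hpl hζ hη hZ hN T).hat).map eV.toMulEquiv.toMonoidHom =
              (MulAut.conj s • ((StableCurveTemperedData.ofSpecialFibre (C.temperedCurveXuuOfLevelData C.l_ne_zero d)
        (C.groupLevelDataXuu C.l_ne_zero d) Sf h36 Sigma SigmaHat hsub hne hprime hp TpH HatH hle cuspMeetsH).inertiaTp y).map
                (StableCurveTemperedData.ofSpecialFibre (C.temperedCurveXuuOfLevelData C.l_ne_zero d)
        (C.groupLevelDataXuu C.l_ne_zero d) Sf h36 Sigma SigmaHat hsub hne hprime hp TpH HatH hle cuspMeetsH).DeltaTp.subtype).map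
              (StableCurveTemperedData.ofSpecialFibre (C.temperedCurveXuuOfLevelData C.l_ne_zero d)
        (C.groupLevelDataXuu C.l_ne_zero d) Sf h36 Sigma SigmaHat hsub hne hprime hp TpH HatH hle cuspMeetsH).ιX)
    {I : Subgroup (ofPiCHat e C μ hC hS hl hp2 hpl hζ hη hZ hN T).Corhat}
    (hI : Cu.IsCuspidalInertia (ofPiCHat e C μ hC hS hl hp2 hpl hζ hη hZ hN T).piV I)
    (l' : ℕ) [Fact l'.Prime] {Λ : Subgroup (ofPiCHat e C μ hC hS hl hp2 hpl hζ hη hZ hN T).Corhat} (hΛI : Λ ≤ I)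
    (hΛ : ∀ x : ↥I, (x : (ofPiCHat e C μ hC hS hl hp2 hpl hζ hη hZ hN T).Corhat) ∈ Λ ↔ ∀ V : OpenNormalSubgroup ↥I, ∃ n : ℕ, x ^ l' ^ n ∈ V.toSubgroup) :
    Rmk241_openOrTrivial' Λ ∧ Nonempty (↥Λ ≃ₜ* Multiplicative ℤ_[l']) ∧ Λ ≠ ⊥ ∧ Infinite ↥Λ := by
  obtain ⟨⟨eI⟩, -⟩ := equiv_zHat_of_isCuspidalInertia_piV_ofPiCHat e C μ hC hS hl hp2 hpl hζ hη hZ hN T d Sf h36 Sigma SigmaHat hsub hne hprime hp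
    TpH HatH hle cuspMeetsH eV hV hdict hI
  exact ⟨rmk241_openOrTrivial'_of_maximalProL_of_equiv_zHat eI hΛI hΛ, nonempty_continuousMulEquiv_padicInt_of_maximalProL eI hΛI hΛ,
    ne_bot_and_infinite_of_maximalProL_of_equiv_zHat eI hΛI hΛ⟩

include d Sfu h36u Sigmau SigmaHatu hsubu hneu hprimeu hpu TpHu HatHu hleu cuspu Sf h36 Sigma SigmaHat hsub hne hprime hp TpH HatH hle
  cuspMeetsH in
/-- **[IUTchII] Rmk 2.4.1 AT THE TOWER OF RECORD — NON-VACUOUS.**  Given ONE cusp `x` of `X`, for EVERY prime `l′`: there are a cuspidal datum `Cu`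
(the agreement datum of record, p441069 / p448223), a cuspidal inertia group `I_t ⊆ Π_v` of it, and its maximal pro-`l′` subgroup `Λ ⊆ I_t`, with
`Rmk241_openOrTrivial' Λ`, `Λ ≃ₜ* ℤ_{l′}` and `Λ ≠ 1` — the instance of F-2063 that print uses is inhabited and PROVED at the genuine tower.
([IUTchII] Rmk 2.4.1, kurims p.71) [cite: Mochizuki2012, II Rmk 2.4.1 p.71] [claim: Mochizuki2012, status: disputed] -/
theorem exists_maximalProL_rmk241_ofPiCHat {x : M.toTemperedCurve.Pt} (hx : M.toTemperedCurve.IsCusp x) (l' : ℕ) [Fact l'.Prime] :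
    ∃ (Cu : CuspidalInertiaData (ofPiCHat e C μ hC hS hl hp2 hpl hζ hη hZ hN T)) (I Λ : Subgroup (ofPiCHat e C μ hC hS hl hp2 hpl hζ hη hZ hN T).Corhat),
      Cu.IsCuspidalInertia (ofPiCHat e C μ hC hS hl hp2 hpl hζ hη hZ hN T).piV I ∧ Λ ≤ I ∧
      (∀ y : ↥I, (y : (ofPiCHat e C μ hC hS hl hp2 hpl hζ hη hZ hN T).Corhat) ∈ Λ ↔ ∀ V : OpenNormalSubgroup ↥I, ∃ n : ℕ, y ^ l' ^ n ∈ V.toSubgroup) ∧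
      Rmk241_openOrTrivial' Λ ∧ Nonempty (↥Λ ≃ₜ* Multiplicative ℤ_[l']) ∧ Λ ≠ ⊥ := by
  obtain ⟨Cu, A, eV, -, -, -, -, -, ⟨I, hI⟩, -, -, hV⟩ := exists_agreements_ofPiCHat_nonVacuous e C μ hC hS hl hp2 hpl hζ hη hZ hN T d Sfu h36u
    Sigmau SigmaHatu hsubu hneu hprimeu hpu TpHu HatHu hleu cuspu Sf h36 Sigma SigmaHat hsub hne hprime hp TpH HatH hle cuspMeetsH hx
  obtain ⟨⟨eI⟩, -⟩ := hV I hI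
  obtain ⟨Λ, hΛI, hΛ⟩ := exists_maximalProL_of_equiv_zHat eI l'
  exact ⟨Cu, I, Λ, hI, hΛI, hΛ, rmk241_openOrTrivial'_of_maximalProL_of_equiv_zHat eI hΛI hΛ,
    nonempty_continuousMulEquiv_padicInt_of_maximalProL eI hΛI hΛ, (ne_bot_and_infinite_of_maximalProL_of_equiv_zHat eI hΛI hΛ).1⟩

end Record

end PlusMinusTower



end Literature.IUT.HodgeArakelov

end
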